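import Literature.Topology.FourManifolds.CircleFamilies
import HarnessLib

/-!
# One-parameter families of circles: coordinate calculus along the lift `(t, θ) ↦ (t, circlePoint θ)`

Topic `Literature/Topology/FourManifolds`; second infrastructure file (after `CircleFamilies.lean`)
for the tree's proof of Whitney's theorem that homotopic embedded circles in a manifold of
dimension `≥ 4` are isotopic (leaf
`Literature.Topology.FourManifolds.Milnor1965_isAmbientIsotopic_of_simplyConnected` of
`HCobordismAuxiliaryPair.lean`).  A smooth family `G : ℝ × S¹ → V` read in an extended chart `φ`
of `V` along the lift `L (t, θ) = (t, circlePoint θ)` is an ordinary smooth map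
`g̃ (t, θ) = φ (G (t, circlePoint θ))` of two real variables on the open set where `G ∘ L` lies in
the chart source, and the θ-velocity of `G` (`Literature.Topology.FourManifolds.thetaVel`)
vanishes exactly where the partial derivative `∂_θ g̃ = D g̃ (t, θ) (0, 1)` does.  For the
perturbed family `Literature.Topology.FourManifolds.chartPerturb G x ρ ℓ (v, w)` the coordinate
function is `g̃ + ρ̃ • (v + ℓ̃ • w)` and its `∂_θ` is `∂_θ g̃ + (∂_θ ρ̃) • v + (∂_θ ρ̃ ℓ̃ + ρ̃ ∂_θ ℓ̃) • w`
— the affine dependence on the parameters `(v, w)` on which the general-position argument of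
`NullImages.lean` operates.  Everything here is proved; no definitions, no named facts.

* `Literature.Topology.FourManifolds.contDiffOn_of_contMDiffOn_prod_self` — `C^n` for the
  product model on `E × F` is `C^n` in the vector-space sense (on a set).
* `Literature.Topology.FourManifolds.contDiffOn_extChartAt_lift`,
  `Literature.Topology.FourManifolds.isOpen_liftSource` — smoothness of `g̃` on its open domain.
* `Literature.Topology.FourManifolds.hasDerivAt_slice` — `r ↦ f (t, r)` has derivative
  `D f (t, θ) (0, 1)`.
* `Literature.Topology.FourManifolds.thetaVel_eq_zero_iff_fderiv_lift_eq_zero` — the θ-velocity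
  vanishes iff `∂_θ g̃` does.
* `Literature.Topology.FourManifolds.fderiv_smul_add_smul_apply` — the `∂_θ` of the affine term
  `ρ̃ • (v + ℓ̃ • w)`.
* `Literature.Topology.FourManifolds.thetaVel_chartPerturb_eq_zero_iff` — the θ-velocity of the
  perturbed family vanishes iff `∂_θ g̃ + ∂_θ (ρ̃ • (v + ℓ̃ • w)) = 0`.

## References

* H. Whitney, *Differentiable manifolds*, Ann. of Math. (2) 37 (1936), 645–680, §§8–9.
  [Whitney1936]
* M. W. Hirsch, *Differential Topology*, GTM 33 (1976), Ch. 3 §2. [HirschDT1976]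
-/

open scoped Manifold ContDiff Topology Real
open Function Set Filter

noncomputable section

namespace Literature.Topology.FourManifolds

/-! ### Vector-space smoothness on products of model spaces -/

/-- A map on a product `E × F` of model vector spaces which is `C^m` on a set for the product
model with corners `𝓘(ℝ, E).prod 𝓘(ℝ, F)` is `C^m` there in the vector-space sense (Mathlib's
`modelWithCornersSelf_prod` / `chartedSpaceSelf_prod`; the global version is the tree's
`contDiff_of_contMDiff_prod_self`, `BandTransport.lean`). [folklore] -/
theorem contDiffOn_of_contMDiffOn_prod_self {E F G : Type*} [NormedAddCommGroup E]
    [NormedSpace ℝ E] [NormedAddCommGroup F] [NormedSpace ℝ F] [NormedAddCommGroup G]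
    [NormedSpace ℝ G] {m : WithTop ℕ∞} {g : E × F → G} {s : Set (E × F)}
    (hg : ContMDiffOn (𝓘(ℝ, E).prod 𝓘(ℝ, F)) 𝓘(ℝ, G) m g s) : ContDiffOn ℝ m g s := by
  rw [← modelWithCornersSelf_prod, chartedSpaceSelf_prod] at hg
  exact contMDiffOn_iff_contDiffOn.1 hg

/-- The lift `(t, θ) ↦ (t, circlePoint θ) : ℝ² → ℝ × S¹` is smooth. [folklore] -/
theorem contMDiff_circleLift :
    ContMDiff (𝓘(ℝ, ℝ).prod 𝓘(ℝ, ℝ)) (𝓘(ℝ, ℝ).prod (𝓡 1)) ∞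
      (fun z : ℝ × ℝ => ((z.1, circlePoint z.2) : ℝ × (Metric.sphere (0 : EuclideanSpace ℝ (Fin 2)) 1))) :=
  contMDiff_fst.prodMk (contMDiff_circlePoint.comp contMDiff_snd)

/-- The lift `(t, θ) ↦ (t, circlePoint θ)` is continuous. [folklore] -/
theorem continuous_circleLift :
    Continuous (fun z : ℝ × ℝ => ((z.1, circlePoint z.2) : ℝ × (Metric.sphere (0 : EuclideanSpace ℝ (Fin 2)) 1))) :=
  continuous_fst.prodMk (continuous_circlePoint.comp continuous_snd)

/-- **Slice derivative.**  If `f : ℝ × ℝ → F` is differentiable at `z = (t, θ)` then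
`r ↦ f (t, r)` has derivative `D f z (0, 1)` at `θ`. [folklore] -/
theorem hasDerivAt_slice {F : Type*} [NormedAddCommGroup F] [NormedSpace ℝ F] {f : ℝ × ℝ → F}
    {z : ℝ × ℝ} (hf : DifferentiableAt ℝ f z) :
    HasDerivAt (fun r : ℝ => f (z.1, r)) (fderiv ℝ f z (0, 1)) z.2 := by
  have hc : HasDerivAt (fun r : ℝ => ((z.1, r) : ℝ × ℝ)) ((0 : ℝ), (1 : ℝ)) z.2 :=
    (hasDerivAt_const z.2 z.1).prodMk (hasDerivAt_id z.2)
  have := hf.hasFDerivAt.comp_hasDerivAt z.2 hc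
  simpa only [Function.comp_def] using this

variable {n : ℕ} {V : Type*} [TopologicalSpace V] [ChartedSpace (EuclideanSpace ℝ (Fin n)) V]

/-! ### The coordinate function `g̃ (t, θ) = φ (G (t, circlePoint θ))` -/

section Coordinates

/-- The domain `{(t, θ) | G (t, circlePoint θ) ∈ chart source}` of the coordinate function is
open, for continuous `G`. [folklore] -/
theorem isOpen_liftSource {G : ℝ × (Metric.sphere (0 : EuclideanSpace ℝ (Fin 2)) 1) → V} (hG : Continuous G) (x : V) :
    IsOpen {z : ℝ × ℝ | G (z.1, circlePoint z.2) ∈ (chartAt (EuclideanSpace ℝ (Fin n)) x).source} :=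
  (chartAt (EuclideanSpace ℝ (Fin n)) x).open_source.preimage (hG.comp continuous_circleLift)

variable [IsManifold (𝓡 n) ∞ V]

/-- **The coordinate function is smooth**: for a smooth family `G` and a chart centre `x`,
`(t, θ) ↦ φ (G (t, circlePoint θ))` (`φ` the extended chart at `x`) is `C^∞` in the vector-space
sense on the open set where `G (t, circlePoint θ)` lies in the chart source. [folklore] -/
theorem contDiffOn_extChartAt_lift {G : ℝ × (Metric.sphere (0 : EuclideanSpace ℝ (Fin 2)) 1) → V}
    (hG : ContMDiff (𝓘(ℝ, ℝ).prod (𝓡 1)) (𝓡 n) ∞ G) (x : V) :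
    ContDiffOn ℝ ∞ (fun z : ℝ × ℝ => extChartAt (𝓡 n) x (G (z.1, circlePoint z.2)))
      {z : ℝ × ℝ | G (z.1, circlePoint z.2) ∈ (chartAt (EuclideanSpace ℝ (Fin n)) x).source} := by
  apply contDiffOn_of_contMDiffOn_prod_self
  have h1 : ContMDiffOn (𝓘(ℝ, ℝ).prod 𝓘(ℝ, ℝ)) (𝓡 n) ∞
      (fun z : ℝ × ℝ => G (z.1, circlePoint z.2))
      {z : ℝ × ℝ | G (z.1, circlePoint z.2) ∈ (chartAt (EuclideanSpace ℝ (Fin n)) x).source} :=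
    (hG.comp contMDiff_circleLift).contMDiffOn
  exact contMDiffOn_extChartAt.comp h1 fun z hz => hz

/-- The coordinate function is differentiable at every point of its domain. [folklore] -/
theorem differentiableAt_extChartAt_lift {G : ℝ × (Metric.sphere (0 : EuclideanSpace ℝ (Fin 2)) 1) → V}
    (hG : ContMDiff (𝓘(ℝ, ℝ).prod (𝓡 1)) (𝓡 n) ∞ G) (x : V) {z : ℝ × ℝ}
    (hz : G (z.1, circlePoint z.2) ∈ (chartAt (EuclideanSpace ℝ (Fin n)) x).source) :
    DifferentiableAt ℝ (fun z : ℝ × ℝ => extChartAt (𝓡 n) x (G (z.1, circlePoint z.2))) z :=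
  ((contDiffOn_extChartAt_lift hG x).differentiableOn (by simp)).differentiableAt
    ((isOpen_liftSource hG.continuous x).mem_nhds hz)

/-- The `∂_θ` of the coordinate function is `C^∞` on the domain (hence differentiable there).
[folklore] -/
theorem contDiffOn_fderiv_extChartAt_lift {G : ℝ × (Metric.sphere (0 : EuclideanSpace ℝ (Fin 2)) 1) → V}
    (hG : ContMDiff (𝓘(ℝ, ℝ).prod (𝓡 1)) (𝓡 n) ∞ G) (x : V) :
    ContDiffOn ℝ ∞
      (fun z : ℝ × ℝ =>
        fderiv ℝ (fun z : ℝ × ℝ => extChartAt (𝓡 n) x (G (z.1, circlePoint z.2))) z (0, 1))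
      {z : ℝ × ℝ | G (z.1, circlePoint z.2) ∈ (chartAt (EuclideanSpace ℝ (Fin n)) x).source} := by
  have h := (contDiffOn_extChartAt_lift hG x).fderiv_of_isOpen (isOpen_liftSource hG.continuous x)
    (m := ∞) (by simp)
  exact h.clm_apply contDiffOn_const

/-- **Bridge to the lift**: for a smooth family `G` and a lifted point `z = (t, θ)` with
`G (t, circlePoint θ)` in the source of the chart at `x`, the θ-velocity `thetaVel n G t θ`
vanishes iff `∂_θ g̃ (z) = D g̃ z (0, 1)` does. [folklore] -/
theorem thetaVel_eq_zero_iff_fderiv_lift_eq_zero {G : ℝ × (Metric.sphere (0 : EuclideanSpace ℝ (Fin 2)) 1) → V}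
    (hG : ContMDiff (𝓘(ℝ, ℝ).prod (𝓡 1)) (𝓡 n) ∞ G) {x : V} {z : ℝ × ℝ}
    (hz : G (z.1, circlePoint z.2) ∈ (chartAt (EuclideanSpace ℝ (Fin n)) x).source) :
    thetaVel n G z.1 z.2 = 0 ↔
      fderiv ℝ (fun z : ℝ × ℝ => extChartAt (𝓡 n) x (G (z.1, circlePoint z.2))) z (0, 1) = 0 := by
  rw [thetaVel_eq_zero_iff_deriv_eq_zero hG hz,
    (hasDerivAt_slice (differentiableAt_extChartAt_lift hG x hz)).deriv]

end Coordinates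

/-! ### The affine perturbation term and its `∂_θ` -/

section Affine

/-- **`∂_θ` of the affine perturbation term.**  For real functions `ρ̃`, `ℓ̃` on `ℝ²`
differentiable at `z` and vectors `v w`:
`D (ρ̃ • (v + ℓ̃ • w)) z (0,1) = (D ρ̃ z (0,1)) • v + (D ρ̃ z (0,1) ℓ̃ z + ρ̃ z D ℓ̃ z (0,1)) • w`.
[folklore] -/
theorem fderiv_smul_add_smul_apply {F : Type*} [NormedAddCommGroup F] [NormedSpace ℝ F]
    {ρ ℓ : ℝ × ℝ → ℝ} {z : ℝ × ℝ} (hρ : DifferentiableAt ℝ ρ z) (hℓ : DifferentiableAt ℝ ℓ z)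
    (v w : F) (e : ℝ × ℝ) :
    fderiv ℝ (fun z => ρ z • (v + ℓ z • w)) z e =
      (fderiv ℝ ρ z e) • v + (fderiv ℝ ρ z e * ℓ z + ρ z * fderiv ℝ ℓ z e) • w := by
  have h1 : (fun z => ρ z • (v + ℓ z • w)) = fun z => ρ z • v + (ρ z * ℓ z) • w := by
    funext z
    rw [smul_add, smul_smul]
  rw [h1]
  have hρv : HasFDerivAt (fun z => ρ z • v) ((fderiv ℝ ρ z).smulRight v) z :=
    hρ.hasFDerivAt.smul_const v
  have hρℓ : HasFDerivAt (fun z => ρ z * ℓ z) (ρ z • fderiv ℝ ℓ z + ℓ z • fderiv ℝ ρ z) z :=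
    hρ.hasFDerivAt.mul hℓ.hasFDerivAt
  have hρℓw : HasFDerivAt (fun z => (ρ z * ℓ z) • w)
      ((ρ z • fderiv ℝ ℓ z + ℓ z • fderiv ℝ ρ z).smulRight w) z :=
    hρℓ.smul_const w
  rw [show (fun z => ρ z • v + (ρ z * ℓ z) • w) =
      (fun z => ρ z • v) + fun z => (ρ z * ℓ z) • w from rfl, (hρv.add hρℓw).fderiv]
  simp only [add_apply, ContinuousLinearMap.smulRight_apply,
    FunLike.coe_smul, Pi.smul_apply, smul_eq_mul]
  congr 1
  ring_nf

/-- The affine perturbation term is differentiable where its coefficient functions are.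
[folklore] -/
theorem differentiableAt_smul_add_smul {F : Type*} [NormedAddCommGroup F] [NormedSpace ℝ F]
    {ρ ℓ : ℝ × ℝ → ℝ} {z : ℝ × ℝ} (hρ : DifferentiableAt ℝ ρ z) (hℓ : DifferentiableAt ℝ ℓ z)
    (v w : F) : DifferentiableAt ℝ (fun z => ρ z • (v + ℓ z • w)) z :=
  hρ.smul (((hℓ.smul_const w)).const_add v)

end Affine

/-! ### The θ-velocity of the perturbed family -/

section Perturbed

variable [IsManifold (𝓡 n) ∞ V]

/-- **θ-velocity of the perturbed family, zero criterion.**  Let `G` be a smooth family, `ρ` a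
smooth bump on `ℝ × S¹` with `tsupport ρ ⊆ R`, `R` open and mapped by `G` into the source of the
chart at `x`, `ℓ` a smooth function on the circle, and `q = (v, w)` a parameter for which the
perturbed coordinates of the points of `R` stay in the chart target.  Then at a lifted point
`z = (t, θ)` with `(t, circlePoint θ) ∈ R`, the θ-velocity of `chartPerturb G x ρ ℓ q` vanishes
iff `∂_θ g̃ (z) + ∂_θ (ρ̃ • (v + ℓ̃ • w)) (z) = 0`, where `g̃`, `ρ̃`, `ℓ̃` are `φ ∘ G`, `ρ`, `ℓ` read
along the lift. [folklore] -/
theorem thetaVel_chartPerturb_eq_zero_iff {G : ℝ × (Metric.sphere (0 : EuclideanSpace ℝ (Fin 2)) 1) → V}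
    (hG : ContMDiff (𝓘(ℝ, ℝ).prod (𝓡 1)) (𝓡 n) ∞ G) {x : V} {ρ : ℝ × (Metric.sphere (0 : EuclideanSpace ℝ (Fin 2)) 1) → ℝ}
    (hρ : ContMDiff (𝓘(ℝ, ℝ).prod (𝓡 1)) 𝓘(ℝ, ℝ) ∞ ρ) {ℓ : (Metric.sphere (0 : EuclideanSpace ℝ (Fin 2)) 1) → ℝ}
    (hℓ : ContMDiff (𝓡 1) 𝓘(ℝ, ℝ) ∞ ℓ) {R : Set (ℝ × (Metric.sphere (0 : EuclideanSpace ℝ (Fin 2)) 1))} (hR : IsOpen R)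
    (hsupp : tsupport ρ ⊆ R) (hsrc : MapsTo G R (chartAt (EuclideanSpace ℝ (Fin n)) x).source) {q : EuclideanSpace ℝ (Fin n) × EuclideanSpace ℝ (Fin n)}
    (htgt : ∀ p ∈ R, extChartAt (𝓡 n) x (G p) + ρ p • (q.1 + ℓ p.2 • q.2) ∈
      (extChartAt (𝓡 n) x).target)
    {z : ℝ × ℝ} (hz : ((z.1, circlePoint z.2) : ℝ × (Metric.sphere (0 : EuclideanSpace ℝ (Fin 2)) 1)) ∈ R) :
    thetaVel n (chartPerturb G x ρ ℓ q) z.1 z.2 = 0 ↔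
      fderiv ℝ (fun z : ℝ × ℝ => extChartAt (𝓡 n) x (G (z.1, circlePoint z.2))) z (0, 1) +
        fderiv ℝ (fun z : ℝ × ℝ => ρ (z.1, circlePoint z.2) • (q.1 + ℓ (circlePoint z.2) • q.2))
          z (0, 1) = 0 := by
  set G' := chartPerturb G x ρ ℓ q with hG'def
  have hG' : ContMDiff (𝓘(ℝ, ℝ).prod (𝓡 1)) (𝓡 n) ∞ G' :=
    contMDiff_chartPerturb hG hρ hℓ hR hsupp hsrc htgt
  have hz' : G' (z.1, circlePoint z.2) ∈ (chartAt (EuclideanSpace ℝ (Fin n)) x).source :=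
    (chartPerturb_mem_source (hsrc hz) (htgt _ hz)).1
  rw [thetaVel_eq_zero_iff_fderiv_lift_eq_zero hG' hz']
  -- the coordinate function of `G'` agrees near `z` with `g̃ + affine term`
  set gt : ℝ × ℝ → EuclideanSpace ℝ (Fin n) := fun z => extChartAt (𝓡 n) x (G (z.1, circlePoint z.2)) with hgt
  set pt : ℝ × ℝ → EuclideanSpace ℝ (Fin n) := fun z =>
    ρ (z.1, circlePoint z.2) • (q.1 + ℓ (circlePoint z.2) • q.2) with hpt
  have hev : (fun z : ℝ × ℝ => extChartAt (𝓡 n) x (G' (z.1, circlePoint z.2))) =ᶠ[𝓝 z]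
      fun z => gt z + pt z := by
    have hO : IsOpen {z : ℝ × ℝ | ((z.1, circlePoint z.2) : ℝ × (Metric.sphere (0 : EuclideanSpace ℝ (Fin 2)) 1)) ∈ R} :=
      hR.preimage continuous_circleLift
    filter_upwards [hO.mem_nhds hz] with z' hz'
    exact (chartPerturb_mem_source (hsrc hz') (htgt _ hz')).2
  rw [hev.fderiv_eq]
  have hgt_d : DifferentiableAt ℝ gt z := differentiableAt_extChartAt_lift hG x (hsrc hz)
  have hρt : ContMDiff (𝓘(ℝ, ℝ).prod 𝓘(ℝ, ℝ)) 𝓘(ℝ, ℝ) ∞ fun z : ℝ × ℝ => ρ (z.1, circlePoint z.2) :=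
    hρ.comp contMDiff_circleLift
  have hℓt : ContMDiff (𝓘(ℝ, ℝ).prod 𝓘(ℝ, ℝ)) 𝓘(ℝ, ℝ) ∞ fun z : ℝ × ℝ => ℓ (circlePoint z.2) :=
    hℓ.comp (contMDiff_circlePoint.comp contMDiff_snd)
  have hρd : DifferentiableAt ℝ (fun z : ℝ × ℝ => ρ (z.1, circlePoint z.2)) z :=
    ((contDiffOn_of_contMDiffOn_prod_self hρt.contMDiffOn (s := univ)).differentiableOn
      (by simp)).differentiableAt Filter.univ_mem
  have hℓd : DifferentiableAt ℝ (fun z : ℝ × ℝ => ℓ (circlePoint z.2)) z :=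
    ((contDiffOn_of_contMDiffOn_prod_self hℓt.contMDiffOn (s := univ)).differentiableOn
      (by simp)).differentiableAt Filter.univ_mem
  have hpt_d : DifferentiableAt ℝ pt z := differentiableAt_smul_add_smul hρd hℓd q.1 q.2
  rw [show (fun z => gt z + pt z) = gt + pt from rfl, fderiv_add hgt_d hpt_d]
  rfl

end Perturbed

end Literature.Topology.FourManifolds
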